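import Summits.Ventures.CertifiedQuantumChemistry.Rows.SingletSpinFlipQuotient
import Summits.Ventures.CertifiedQuantumChemistry.Rows.DifferenceRows
import HarnessLib

/-!
# Ventures/CertifiedQuantumChemistry — Rows/OpaqueNodes.lean: MODEL-PARAMETRIC claim-node schema for pinned
# files too large for literal tables (`k > 16`)

HONEST FRAMING (verbatim): certified bounds for a stated model Hamiltonian in a stated basis; not a claim
about the real molecule or material beyond that model.

LADDER-CHEM I-TYPE slot 07 (cell chem-oracle, seat chem-type-07; chem-lead ruling B6-4 R1/R2 on design note
`typed/OPAQUE-NODE.md`, shape (B); zero compute; PROVED glue, 0 sorry; node PREDICATES with parameters — nothing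
is asserted about any pinned file, no node is instantiated here). A `k > 16` model has NO Lean constant (literal
tables stop at `k = 16`; no axiom / opaque; sha256 is reader-side): its claim node is a PREDICATE ON THE MODEL
`Node … (F : Model k) : Prop` whose body is VERBATIM the certificate hypothesis of the lemma of record; the row
theorem is that lemma, universally quantified over `F`; the pin enters as a `PinnedSector` value (key by
`decide`) and «`F` = the exact tables of the pinned file» stays reader-side (W4), visibly, in the binder.
* `NecessaryLowerNode C lo` — `lo ≤ Re E_F(γ, Γ)` on every `C`-feasible pair: the `hlo` binder of
  `lowerRow_of_forall_necessary` (programme `qcl1`, any rung `C`).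
* `FlipLowerNode C lo` — the same on the `θ`-SYMMETRIC `C`-feasible pairs: the `hlo` binder of
  `lowerRow_of_forall_necessary_flip` (`qcl1f`, `M = 0` spin-flip quotient — NOT an `S = 0` claim); named rungs
  `FlipDQGLowerNode n lo` (binder of `lowerRow_of_forall_isDQGFeasibleSector_flip`, the lemma of record of
  CERTIFIED-CHEM rows #1–#4, #8) and `FlipDQGT1LowerNode n lo`.
* `SectorLowerNode a b lo` / `UpperNode a b hi` — the operator-SOS / Rayleigh–Ritz predicates `LowerCertificate`
  / `UpperCertificate` of `Rows/SectorRows.lean`, model last (rows #5, #7: `upperRow_of_certificate`). Singlet SOS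
  / RR nodes ARE `SingletLowerCertificate` / `SingletUpperCertificate` (`Rows/SingletRows.lean`); the a-posteriori
  (`dyadic-eig`, certified-fp) route keeps the raw binders of `APosteriori.lowerRow_of_dyadicEigCertificate(_flip)`.
READINGS (one lemma application each): `.lowerRow`, `.singletLowerRow` (singlet twins), `.upperRow`, `.bracket`
(L-node ∧ U-node on ONE binder `F`, row #6), `.diffBracket` (`dE-from-absolutes` over TWO binders), `.flip`.
PER-ROW FILE (type-01's lane, zero tables): record `S : PinnedSector`, `S.absKey = "<key>"` by `decide`,
`(F : Model <norb>) (hM : F.MatchesPin S) (hF : F.IsEightfold) (h : FlipDQGLowerNode <n> <lo> F) : LowerRow F <n>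
<n> <lo> := h.lowerRow hF.isSymmetric hM.range.1`. KERNEL: the algebra for EVERY rational model of that shape +
slot arithmetic + key ↔ record; READER-side: tables ↔ bytes ↔ model_sha256, `IsEightfold`, the node's premise.
-/

namespace Summit.Ventures.CertifiedQuantumChemistry

open Literature.MathematicalPhysics.QuantumLattice Literature.MathematicalPhysics.QuantumChemistry

variable {k kA kB : ℕ} {C : APosteriori.PairCondition k} {lo hi : ℚ} {F : Model k} {a b n : ℕ}

/-! ## §1 The `∀`-binder nodes (necessity route, flip-quotient route) and their readings -/

/-- **NECESSITY-ROUTE NODE** (model-parametric): `lo` lies below the energy functional of `F`'s exact tables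
on EVERY `C`-feasible RDM pair — verbatim the `hlo` binder of `lowerRow_of_forall_necessary` (CSL: "since
`𝒞_app ⊃ 𝒞_N`, the energy `E_app` is a lower bound to the full CI energy in the chosen basis").
[cite: CancesStoltzLewin2006, §3 eqs. (9)-(10)] -/
def NecessaryLowerNode (C : APosteriori.PairCondition k) (lo : ℚ) (F : Model k) : Prop :=
  ∀ γ Γ, C γ Γ → ((lo : ℚ) : ℝ) ≤
    (rdmEnergy (fun p q => (F.h p q : ℂ)) (fun p q r s => (F.eri p q r s : ℂ)) (F.ecore : ℂ) γ Γ).re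

/-- **FLIP-QUOTIENT NODE** (model-parametric): the same on the `θ`-SYMMETRIC `C`-feasible pairs only
(`θ = Orb.spinSwap`) — verbatim the `hlo` binder of `lowerRow_of_forall_necessary_flip` (the `M = 0` block
structure of the 2-RDM programme). [cite: Mazziotti2007RDMChapter, §II.F p.48] -/
def FlipLowerNode (C : APosteriori.PairCondition k) (lo : ℚ) (F : Model k) : Prop :=
  ∀ γ Γ, C γ Γ →
    (∀ i k', γ (Orb.spinSwap i) (Orb.spinSwap k') = γ i k') →
    (∀ i j k' l,
      Γ (Orb.spinSwap i, Orb.spinSwap j) (Orb.spinSwap k', Orb.spinSwap l) = Γ (i, j) (k', l)) →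
    ((lo : ℚ) : ℝ) ≤
      (rdmEnergy (fun p q => (F.h p q : ℂ)) (fun p q r s => (F.eri p q r s : ℂ)) (F.ecore : ℂ) γ Γ).re

/-- Named rung `DQG --flip`: the binder of `lowerRow_of_forall_isDQGFeasibleSector_flip` (lemma of record of
CERTIFIED-CHEM rows #1–#4, #8). [cite: Mazziotti2007RDMChapter, §II.F p.48] -/
abbrev FlipDQGLowerNode (n : ℕ) (lo : ℚ) (F : Model k) : Prop := FlipLowerNode (IsDQGFeasibleSector n n) lo F

/-- Named rung `DQGT1 --flip`: binder of `lowerRow_of_forall_isDQGT1FeasibleSector_flip`. [cite: NakataEtAl2008, §II.C] -/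
abbrev FlipDQGT1LowerNode (n : ℕ) (lo : ℚ) (F : Model k) : Prop :=
  FlipLowerNode (IsDQGT1FeasibleSector n n) lo F

/-- A full-programme node is a flip node (the `θ`-symmetric feasible pairs are feasible pairs). -/
theorem NecessaryLowerNode.flip (h : NecessaryLowerNode C lo F) : FlipLowerNode C lo F :=
  fun γ Γ hC _ _ => h γ Γ hC

/-- READING: node ⇒ sector LOWER row, `C` necessary in the sector `(a, b)` (`lowerRow_of_forall_necessary`). -/
theorem NecessaryLowerNode.lowerRow (h : NecessaryLowerNode C lo F) (hF : F.IsSymmetric) (ha : a ≤ k)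
    (hb : b ≤ k) (hC : IsNecessaryInSector a b C) : LowerRow F a b lo :=
  lowerRow_of_forall_necessary hF ha hb hC h

/-- Singlet twin: node ⇒ SINGLET lower row, `C` singlet-necessary (`singletLowerRow_of_forall_necessary`). -/
theorem NecessaryLowerNode.singletLowerRow (h : NecessaryLowerNode C lo F) (hn : n ≤ k)
    (hC : IsNecessaryInSpinClass n n C) : SingletLowerRow F n lo :=
  singletLowerRow_of_forall_necessary hn hC h

/-- READING: flip node ⇒ LOWER row at a balanced sector `(n, n)` (`lowerRow_of_forall_necessary_flip`). -/
theorem FlipLowerNode.lowerRow (h : FlipLowerNode C lo F) (hF : F.IsSymmetric) (hn : n ≤ k)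
    (hC : IsNecessaryInSector n n C) : LowerRow F n n lo :=
  lowerRow_of_forall_necessary_flip hF hn hC h

/-- Singlet twin: flip node ⇒ SINGLET lower row (`singletLowerRow_of_forall_necessary_flip`). -/
theorem FlipLowerNode.singletLowerRow (h : FlipLowerNode C lo F) (hF : F.IsSymmetric) (hn : n ≤ k)
    (hC : IsNecessaryInSpinClass n n C) : SingletLowerRow F n lo :=
  singletLowerRow_of_forall_necessary_flip hF hn hC h

/-- Rows #1–#4, #8: this IS `lowerRow_of_forall_isDQGFeasibleSector_flip`. [cite: Mazziotti2007RDMChapter, §II.F p.48] -/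
theorem FlipDQGLowerNode.lowerRow (h : FlipDQGLowerNode n lo F) (hF : F.IsSymmetric) (hn : n ≤ k) :
    LowerRow F n n lo :=
  lowerRow_of_forall_isDQGFeasibleSector_flip hF hn h

/-- This IS `lowerRow_of_forall_isDQGT1FeasibleSector_flip`. [cite: NakataEtAl2008, §II.C] -/
theorem FlipDQGT1LowerNode.lowerRow (h : FlipDQGT1LowerNode n lo F) (hF : F.IsSymmetric) (hn : n ≤ k) :
    LowerRow F n n lo :=
  lowerRow_of_forall_isDQGT1FeasibleSector_flip hF hn h

/-! ## §2 SOS / Rayleigh–Ritz nodes (tree predicates, model last); bracket and difference corollaries -/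

/-- **SOS LOWER NODE** = `LowerCertificate F a b lo` (FORMAT-qcl1 operator identity), model last. -/
abbrev SectorLowerNode (a b : ℕ) (lo : ℚ) (F : Model k) : Prop := LowerCertificate F a b lo

/-- **UPPER NODE** = `UpperCertificate F a b hi` (FORMAT-qcu0 Rayleigh–Ritz witness in the sector), model last. -/
abbrev UpperNode (a b : ℕ) (hi : ℚ) (F : Model k) : Prop := UpperCertificate F a b hi

/-- SOS node ⇒ lower row IS `lowerRow_of_certificate`. -/
theorem SectorLowerNode.lowerRow (h : SectorLowerNode a b lo F) (hF : F.IsSymmetric) (ha : a ≤ k) (hb : b ≤ k) :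
    LowerRow F a b lo :=
  lowerRow_of_certificate hF ha hb h

/-- Rows #5, #7: upper node ⇒ upper row IS `upperRow_of_certificate` (the witness supplies the range). -/
theorem UpperNode.upperRow (h : UpperNode a b hi F) (hF : F.IsSymmetric) : UpperRow F a b hi :=
  upperRow_of_certificate hF h

/-- Row #6's shape: a flip L-node and a U-node on the SAME binder `F` give `Bracket F n n lo hi`. -/
theorem FlipLowerNode.bracket (hL : FlipLowerNode C lo F) (hF : F.IsSymmetric) (hn : n ≤ k)
    (hC : IsNecessaryInSector n n C) (hU : UpperNode n n hi F) : Bracket F n n lo hi :=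
  ⟨hL.lowerRow hF hn hC, hU.upperRow hF⟩

/-- Row #6 verbatim (`DQG --flip` L ∧ MPS/CI U on one `F : Model k`): `hL.bracket hF.isSymmetric hM.range.1 hU`. -/
theorem FlipDQGLowerNode.bracket (hL : FlipDQGLowerNode n lo F) (hF : F.IsSymmetric) (hn : n ≤ k)
    (hU : UpperNode n n hi F) : Bracket F n n lo hi :=
  ⟨hL.lowerRow hF hn, hU.upperRow hF⟩

/-- The same with a necessity-route L-node in any sector `(a, b)`. -/
theorem NecessaryLowerNode.bracket (hL : NecessaryLowerNode C lo F) (hF : F.IsSymmetric) (ha : a ≤ k)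
    (hb : b ≤ k) (hC : IsNecessaryInSector a b C) (hU : UpperNode a b hi F) : Bracket F a b lo hi :=
  ⟨hL.lowerRow hF ha hb hC, hU.upperRow hF⟩

/-- `dE-from-absolutes` over TWO opaque binders: flip L-node ∧ U-node on `FA : Model kA` and on `FB : Model kB`
give `DiffBracket FA n n FB m m (loA − hiB) (hiA − loB)` (`diffBracket_of_brackets`; width `W_A + W_B`). -/
theorem FlipLowerNode.diffBracket {CA : APosteriori.PairCondition kA} {CB : APosteriori.PairCondition kB}
    {FA : Model kA} {FB : Model kB} {m : ℕ} {loA hiA loB hiB : ℚ} (hLA : FlipLowerNode CA loA FA)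
    (hFA : FA.IsSymmetric) (hn : n ≤ kA) (hCA : IsNecessaryInSector n n CA) (hUA : UpperNode n n hiA FA)
    (hLB : FlipLowerNode CB loB FB) (hFB : FB.IsSymmetric) (hm : m ≤ kB) (hCB : IsNecessaryInSector m m CB)
    (hUB : UpperNode m m hiB FB) : DiffBracket FA n n FB m m (loA - hiB) (hiA - loB) :=
  diffBracket_of_brackets (hLA.bracket hFA hn hCA hUA) (hLB.bracket hFB hm hCB hUB)

end Summit.Ventures.CertifiedQuantumChemistry
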